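import Summits.AtomisticToContinuum.Crystallization.Theorems.FreeSplittingCertificatesStrictSplittingRuleP1CellMomentsThirdAll
import Summits.AtomisticToContinuum.Crystallization.Theorems.FreeSplittingCertificatesStrictSplittingRuleP1HatSecondMomentBound

/-!
# `StrictSplittingRule` (stmt-AtomisticToContinuum-12560): the EXACT second-moment matrix of a hat function of the quarter triangulation — `Σ₂ = [[a²/8, −(√3/72)a², 0], [·, 7a²/72, 0], [0, 0, h²/6]]` (P1 interpolant object, part 28)

Route `FreeSplittingCertificates`, crux r3 `StrictSplittingRule` (H12⋆ = `stub_coreJointCoercive`), unit b2b-freesplit-B gen 27.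
VALUE = the second-order input of the per-site domination TAIL lemma in exact form (HOME FAR-LEMMA-SPEC §20 (c)): the radial Schur complement needs a
PSD LOWER bound of the tangential second moments of the hat distribution, which Jensen/Cauchy–Schwarz cannot supply; with the third-order simplex moments
of parts 26–27: per cell `∫_Tλ_m(y−y_m)_k(y−y_m)_l = (√3a²h/1440)·[Σ_{m'}e_{m',k}e_{m',l} + s_ks_l]` (`e_{m'} = y_{m'} − y_m`, `s = Σ_{m'}e_{m'}`;
`setIntegral_p1Lam_mul_coord_sub_mul`), and over the 24-cell star (edge multiset of part 25: `E = [[30, −(10/3)√3, 0],[·,70/3,0],[0,0,40h²/a²]]a²`; cell-sum part `C = 2E` via the cell list `p1Star_sum_cells`; `Σ₂ = (E + C)/720`)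
**`Σ_{incidences}∫_Tλ_q(y−y_q)_k(y−y_q)_l = (√3a²h/2)·Σ₂,kl`, `Σ₂ = [[a²/8, −(√3/72)a², 0], [−(√3/72)a², 7a²/72, 0], [0, 0, h²/6]]`** for BOTH parities
(`p1Hat_secondMoment`): `tr Σ₂ = (2/9)a² + h²/6` (`= a²/3` at the ideal ratio; Jensen gave exactly twice this), eigenvalues `a²/12`, `5a²/36`, `h²/6` —
the in-plane anisotropy and the off-diagonal `−(√3/72)a²` are the quarter triangulation's trace at second order.  NOT a proof of H12⋆, NOT summit
progress.  [folklore: P1 finite elements / Dirichlet simplex integrals]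
-/

noncomputable section

open Set Function Metric MeasureTheory Filter Topology
open scoped BigOperators NNReal ENNReal

namespace Summit.AtomisticToContinuum.Crystallization.Theorems.StrictSplittingRuleBirth

open Summit.AtomisticToContinuum.Crystallization.Theorems.PalmUnimodularRigidity.LayeredLawsSelectHcp
  (hcpSite hcpSite_apply_zero hcpSite_apply_one hcpSite_apply_two)
open Literature.MathematicalPhysics.StatisticalMechanics (haggLabel alternatingHagg haggLabel_alternating)

/-- **Third-order moments of a real cell**: `∫_T λ_mλ_jλ_{j'} = (√3a²h/2)·(1/120 | 1/360 | 1/720)`. -/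
theorem setIntegral_p1Lam_mul3 {a h : ℝ} (ha : 0 < a) (hh : 0 < h) (i : (ℤ × ℤ × ℤ) × Fin 6) (m j j' : Fin 4) :
    ∫ y in p1RealCell a h i, p1Lam a h i m y * p1Lam a h i j y * p1Lam a h i j' y =
      √3 * a ^ 2 * h / 2 * (if m = j ∧ j = j' then 1 / 120 else if m = j ∨ j = j' ∨ m = j' then 1 / 360 else 1 / 720) := by
  have hg : Measurable fun q : Fin 3 → ℝ => p1Bary (p1Par i.1) i.2 m q * p1Bary (p1Par i.1) i.2 j q * p1Bary (p1Par i.1) i.2 j' q := by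
    have : Continuous fun q : Fin 3 → ℝ => p1Bary (p1Par i.1) i.2 m q * p1Bary (p1Par i.1) i.2 j q * p1Bary (p1Par i.1) i.2 j' q := by
      unfold p1Bary; fun_prop
    exact this.measurable
  have key := setIntegral_p1RealCell_transport ha hh i hg
  have haff : ∫ y in p1RealCell a h i, p1Lam a h i m y * p1Lam a h i j y * p1Lam a h i j' y =
      ∫ y in p1RealCell a h i, (fun q => p1Bary (p1Par i.1) i.2 m q * p1Bary (p1Par i.1) i.2 j q * p1Bary (p1Par i.1) i.2 j' q)
        ((p1ChartInvAff a h i.1.1 0 - p1Vec i.1) + p1ChartInvCLM a h i.1.1 y) := by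
    refine setIntegral_congr_fun (isClosed_p1RealCell a h i).measurableSet fun y hy => ?_
    have hs := p1RealCell_slab hy
    have hX : p1ChartInv a h y - p1Vec i.1 = (p1ChartInvAff a h i.1.1 0 - p1Vec i.1) + p1ChartInvCLM a h i.1.1 y := by
      rw [p1ChartInv_eq_clm a h i.1.1 hs.1 hs.2]; abel
    simp only [p1Lam, hX]
  rw [haff, key, setIntegral_p1Bary_mul3_p1RefCell]

/-- Integrability of `λ_m·λ_j·λ_{j'}` on a real cell. -/
theorem integrableOn_p1Lam_mul3 {a h : ℝ} (ha : 0 < a) (hh : 0 < h) (i : (ℤ × ℤ × ℤ) × Fin 6) (m j j' : Fin 4) :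
    IntegrableOn (fun y => p1Lam a h i m y * p1Lam a h i j y * p1Lam a h i j' y) (p1RealCell a h i) volume :=
  (((continuous_p1Lam a h i m).mul (continuous_p1Lam a h i j)).mul (continuous_p1Lam a h i j')).continuousOn.integrableOn_compact
    (isCompact_p1RealCell ha.ne' hh.ne' i)

/-- **Second moment of a hat function over a cell** (coordinates `k, l`, relative to its vertex `y_m`):
`∫_T λ_m(y)(y_k − (y_m)_k)(y_l − (y_m)_l) dy = (√3a²h/1440)·[Σ_{m'} e_{m',k}e_{m',l} + (Σ_{m'}e_{m',k})(Σ_{m'}e_{m',l})]`, `e_{m'} = y_{m'} − y_m`. -/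
theorem setIntegral_p1Lam_mul_coord_sub_mul {a h : ℝ} (ha : 0 < a) (hh : 0 < h) (i : (ℤ × ℤ × ℤ) × Fin 6) (m : Fin 4) (k l : Fin 3) :
    ∫ y in p1RealCell a h i, p1Lam a h i m y * ((y k - hcpSite a h (i.1 + p1VertOff (p1Par i.1) i.2 m) k) *
        (y l - hcpSite a h (i.1 + p1VertOff (p1Par i.1) i.2 m) l)) =
      √3 * a ^ 2 * h / 1440 *
        ((∑ m' : Fin 4, (hcpSite a h (i.1 + p1VertOff (p1Par i.1) i.2 m') k - hcpSite a h (i.1 + p1VertOff (p1Par i.1) i.2 m) k) *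
            (hcpSite a h (i.1 + p1VertOff (p1Par i.1) i.2 m') l - hcpSite a h (i.1 + p1VertOff (p1Par i.1) i.2 m) l)) +
          (∑ m' : Fin 4, (hcpSite a h (i.1 + p1VertOff (p1Par i.1) i.2 m') k - hcpSite a h (i.1 + p1VertOff (p1Par i.1) i.2 m) k)) *
            (∑ m' : Fin 4, (hcpSite a h (i.1 + p1VertOff (p1Par i.1) i.2 m') l - hcpSite a h (i.1 + p1VertOff (p1Par i.1) i.2 m) l))) := by
  set ym : Fin 4 → Fin 3 → ℝ := fun m' c => hcpSite a h (i.1 + p1VertOff (p1Par i.1) i.2 m') c with hym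
  set e : Fin 4 → Fin 3 → ℝ := fun m' c => ym m' c - ym m c with he
  have hmeas : MeasurableSet (p1RealCell a h i) := (isClosed_p1RealCell a h i).measurableSet
  have hrep : ∀ y ∈ p1RealCell a h i, ∀ c : Fin 3, y c - ym m c = ∑ m' : Fin 4, p1Lam a h i m' y * e m' c := by
    intro y hy c
    have h1 := sum_p1Lam_eq_one a h i y
    have h2 := sum_p1Lam_mul_hcpSite ha.ne' hh.ne' hy c
    simp only [he, hym, mul_sub, Finset.sum_sub_distrib, ← Finset.sum_mul, h1, h2, one_mul]
  have hpt : ∀ y ∈ p1RealCell a h i, p1Lam a h i m y * ((y k - ym m k) * (y l - ym m l)) =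
      ∑ j : Fin 4, ∑ j' : Fin 4, e j k * e j' l * (p1Lam a h i m y * p1Lam a h i j y * p1Lam a h i j' y) := by
    intro y hy
    rw [hrep y hy k, hrep y hy l, Finset.sum_mul_sum, Finset.mul_sum]
    refine Finset.sum_congr rfl fun j _ => ?_
    rw [Finset.mul_sum]
    refine Finset.sum_congr rfl fun j' _ => ?_
    ring
  rw [setIntegral_congr_fun hmeas hpt, integral_finsetSum _ (fun j _ => integrable_finsetSum _ fun j' _ => (integrableOn_p1Lam_mul3 ha hh i m j j').const_mul _)]
  simp only [integral_finsetSum _ (fun j' _ => (integrableOn_p1Lam_mul3 ha hh i m _ j').const_mul _), integral_const_mul,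
    setIntegral_p1Lam_mul3 ha hh]
  simp only [Fin.sum_univ_four]
  fin_cases m <;> (simp only [Fin.zero_eta, Fin.mk_one, Fin.reduceFinMk, Fin.isValue]; simp [he]; ring)

/-- **The cell list of the star** (pure table computation): for any `F` on (corner, piece), the incidence sum of `F(o, π)` over the 24 cells
`(q − o, π)` having `q` as a vertex. -/
theorem p1Star_sum_cells (q : ℤ × ℤ × ℤ) (F : ℤ × ℤ × ℤ → Fin 6 → ℝ) :
    (∑ o ∈ p1Corners, ∑ π : Fin 6, ∑ m : Fin 4, if p1VertOff (p1Par (q - o)) π m = o then F o π else 0) =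
      if Even q.1 then
        (F (0, 0, 0) 0 + F (0, 0, 1) 0 + F (0, 0, 1) 2 + F (0, 0, 1) 3 + F (0, 0, 1) 4 + F (0, 0, 1) 5 + F (0, 1, 0) 0 + F (0, 1, 0) 2 + F (0, 1, 0) 3 + F (0, 1, 1) 1 + F (0, 1, 1) 2 + F (0, 1, 1) 5 + F (1, 0, 0) 0 + F (1, 0, 1) 0 + F (1, 0, 1) 2 + F (1, 0, 1) 3 + F (1, 0, 1) 4 + F (1, 0, 1) 5 + F (1, 1, 0) 0 + F (1, 1, 0) 2 + F (1, 1, 0) 3 + F (1, 1, 1) 1 + F (1, 1, 1) 2 + F (1, 1, 1) 5)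
      else
        (F (0, 0, 0) 0 + F (0, 0, 0) 3 + F (0, 0, 0) 4 + F (0, 0, 1) 1 + F (0, 0, 1) 4 + F (0, 0, 1) 5 + F (0, 1, 0) 1 + F (0, 1, 0) 2 + F (0, 1, 0) 3 + F (0, 1, 0) 4 + F (0, 1, 0) 5 + F (0, 1, 1) 1 + F (1, 0, 0) 0 + F (1, 0, 0) 3 + F (1, 0, 0) 4 + F (1, 0, 1) 1 + F (1, 0, 1) 4 + F (1, 0, 1) 5 + F (1, 1, 0) 1 + F (1, 1, 0) 2 + F (1, 1, 0) 3 + F (1, 1, 0) 4 + F (1, 1, 0) 5 + F (1, 1, 1) 1) := by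
  obtain ⟨qk, qi, qj⟩ := q
  have hbot : ∀ i j : ℤ, p1Par ((qk, qi, qj) - (0, i, j)) = decide (Even qk) := fun i j => by simp [p1Par]
  have htop : ∀ i j : ℤ, p1Par ((qk, qi, qj) - (1, i, j)) = !decide (Even qk) := fun i j => by
    by_cases hk : Even qk
    · have hk1 : ¬Even (qk - 1) := by rw [Int.even_sub_one]; exact not_not.2 hk
      simp [p1Par, hk, hk1]
    · have hk1 : Even (qk - 1) := by rw [Int.even_sub_one]; exact hk
      simp [p1Par, hk, hk1]
  simp only [p1Corners, Finset.sum_insert, Finset.mem_insert, Finset.mem_singleton, Prod.mk.injEq, Finset.sum_singleton,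
    zero_ne_one, one_ne_zero, and_false, and_true, or_self, not_false_eq_true, hbot, htop]
  rcases Int.even_or_odd qk with hk | hk
  · simp only [hk, decide_true, Bool.not_true, if_true]
    simp only [Fin.sum_univ_six, Fin.sum_univ_four, p1VertOff, Prod.mk.injEq]
    norm_num
    ring
  · have hk0 : ¬Even qk := Int.not_even_iff_odd.2 hk
    simp only [hk0, decide_false, Bool.not_false, if_false]
    simp only [Fin.sum_univ_six, Fin.sum_univ_four, p1VertOff, Prod.mk.injEq]
    norm_num
    ring

/-- Coordinate differences of two hcp sites (pure evaluation of `hcpSite`). -/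
theorem hcpSite_sub_apply (a h : ℝ) (u v : ℤ × ℤ × ℤ) (k : Fin 3) :
    hcpSite a h u k - hcpSite a h v k =
      ![a * (((u.2.1 : ℤ) : ℝ) - v.2.1 + (((u.2.2 : ℤ) : ℝ) - v.2.2) / 2 +
            (((haggLabel alternatingHagg u.1 : ℤ) : ℝ) - haggLabel alternatingHagg v.1) / 2),
        a * √3 / 2 * (((u.2.2 : ℤ) : ℝ) - v.2.2 + (((haggLabel alternatingHagg u.1 : ℤ) : ℝ) - haggLabel alternatingHagg v.1) / 3),
        (((u.1 : ℤ) : ℝ) - v.1) * h] k := by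
  fin_cases k <;> simp [hcpSite_apply_zero, hcpSite_apply_one, hcpSite_apply_two] <;> ring

/-- The edge-sum part evaluated: `Σ_{edges} e_ke_l` over the star's edge multiset (part 25). -/
theorem p1StarSum_edgeprod (a h : ℝ) (q : ℤ × ℤ × ℤ) (k l : Fin 3) :
    (let G : ℤ × ℤ × ℤ → ℝ := fun d => (hcpSite a h (q + d) k - hcpSite a h q k) * (hcpSite a h (q + d) l - hcpSite a h q l)
     if Even q.1 then
        (4 * G (-1, -1, 0) + 6 * G (-1, 0, -1) + 6 * G (-1, 0, 0) + 4 * G (-1, 1, -1) + 6 * G (0, -1, 0) + 6 * G (0, -1, 1) +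
          4 * G (0, 0, -1) + 24 * G (0, 0, 0) + 4 * G (0, 0, 1) + 6 * G (0, 1, -1) + 6 * G (0, 1, 0) + 4 * G (1, -1, 0) +
          6 * G (1, 0, -1) + 6 * G (1, 0, 0) + 4 * G (1, 1, -1))
      else
        (4 * G (-1, -1, 1) + 6 * G (-1, 0, 0) + 6 * G (-1, 0, 1) + 4 * G (-1, 1, 0) + 6 * G (0, -1, 0) + 6 * G (0, -1, 1) +
          4 * G (0, 0, -1) + 24 * G (0, 0, 0) + 4 * G (0, 0, 1) + 6 * G (0, 1, -1) + 6 * G (0, 1, 0) + 4 * G (1, -1, 1) +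
          6 * G (1, 0, 0) + 6 * G (1, 0, 1) + 4 * G (1, 1, 0))) =
      (!![30 * a ^ 2, -(10 / 3) * √3 * a ^ 2, 0; -(10 / 3) * √3 * a ^ 2, 70 / 3 * a ^ 2, 0; 0, 0, 40 * h ^ 2] : Matrix (Fin 3) (Fin 3) ℝ) k l := by
  obtain ⟨qk, qi, qj⟩ := q
  have h3 : √3 * √3 = 3 := Real.mul_self_sqrt (by norm_num)
  simp only [hcpSite_sub_apply]
  rcases Int.even_or_odd qk with hk | hk
  · have hk1 : ¬Even (qk + 1) := by rw [Int.even_add_one]; exact not_not.2 hk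
    have hk2 : ¬Even (qk + -1) := by rw [← sub_eq_add_neg, Int.even_sub_one]; exact not_not.2 hk
    fin_cases k <;> fin_cases l <;>
      simp [hk, hk1, hk2, haggLabel_alternating] <;>
      first | ring1 | linear_combination (70 / 9 * a ^ 2) * h3
  · have hk0 : ¬Even qk := Int.not_even_iff_odd.2 hk
    have hk1 : Even (qk + 1) := by rw [Int.even_add_one]; exact hk0
    have hk2 : Even (qk + -1) := by rw [← sub_eq_add_neg, Int.even_sub_one]; exact hk0
    fin_cases k <;> fin_cases l <;>
      simp [hk0, hk1, hk2, haggLabel_alternating] <;>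
      first | ring1 | linear_combination (70 / 9 * a ^ 2) * h3

/-- Coordinate differences `y_{q−o+v} − y_q`, same layer (`o.1 = v.1 = 0`): pure evaluation of `hcpSite`. -/
theorem hcpSite_diff00 (a h : ℝ) (qk qi qj oi oj vi vj : ℤ) (k : Fin 3) :
    hcpSite a h ((qk, qi, qj) - (0, oi, oj) + (0, vi, vj)) k - hcpSite a h (qk, qi, qj) k =
      ![a * (((vi - oi : ℤ) : ℝ) + ((vj - oj : ℤ) : ℝ) / 2), a * √3 / 2 * ((vj - oj : ℤ) : ℝ), 0] k := by
  fin_cases k <;> simp [hcpSite_apply_zero, hcpSite_apply_one, hcpSite_apply_two] <;> ring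

/-- Coordinate differences `y_{q−o+v} − y_q`, same layer (`o.1 = v.1 = 1`). -/
theorem hcpSite_diff11 (a h : ℝ) (qk qi qj oi oj vi vj : ℤ) (k : Fin 3) :
    hcpSite a h ((qk, qi, qj) - (1, oi, oj) + (1, vi, vj)) k - hcpSite a h (qk, qi, qj) k =
      ![a * (((vi - oi : ℤ) : ℝ) + ((vj - oj : ℤ) : ℝ) / 2), a * √3 / 2 * ((vj - oj : ℤ) : ℝ), 0] k := by
  fin_cases k <;> simp [hcpSite_apply_zero, hcpSite_apply_one, hcpSite_apply_two] <;> ring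

/-- Coordinate differences `y_{q−o+v} − y_q`, even layer `q.1`, vertex one layer up (`o.1 = 0`, `v.1 = 1`). -/
theorem hcpSite_diff_even01 (a h : ℝ) {qk : ℤ} (hk : Even qk) (qi qj oi oj vi vj : ℤ) (k : Fin 3) :
    hcpSite a h ((qk, qi, qj) - (0, oi, oj) + (1, vi, vj)) k - hcpSite a h (qk, qi, qj) k =
      ![a * (((vi - oi : ℤ) : ℝ) + ((vj - oj : ℤ) : ℝ) / 2 + 1 / 2), a * √3 / 2 * (((vj - oj : ℤ) : ℝ) + 1 / 3), h] k := by
  have hk1 : ¬Even (qk + 1) := by rw [Int.even_add_one]; exact not_not.2 hk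
  fin_cases k <;> simp [hcpSite_apply_zero, hcpSite_apply_one, hcpSite_apply_two, haggLabel_alternating, hk, hk1] <;> ring

/-- Coordinate differences `y_{q−o+v} − y_q`, even layer, vertex one layer down (`o.1 = 1`, `v.1 = 0`). -/
theorem hcpSite_diff_even10 (a h : ℝ) {qk : ℤ} (hk : Even qk) (qi qj oi oj vi vj : ℤ) (k : Fin 3) :
    hcpSite a h ((qk, qi, qj) - (1, oi, oj) + (0, vi, vj)) k - hcpSite a h (qk, qi, qj) k =
      ![a * (((vi - oi : ℤ) : ℝ) + ((vj - oj : ℤ) : ℝ) / 2 + 1 / 2), a * √3 / 2 * (((vj - oj : ℤ) : ℝ) + 1 / 3), -h] k := by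
  have hk1 : ¬Even (qk - 1) := by rw [Int.even_sub_one]; exact not_not.2 hk
  fin_cases k <;> simp [hcpSite_apply_zero, hcpSite_apply_one, hcpSite_apply_two, haggLabel_alternating, hk, hk1] <;> ring

/-- Coordinate differences `y_{q−o+v} − y_q`, odd layer, vertex one layer up. -/
theorem hcpSite_diff_odd01 (a h : ℝ) {qk : ℤ} (hk : ¬Even qk) (qi qj oi oj vi vj : ℤ) (k : Fin 3) :
    hcpSite a h ((qk, qi, qj) - (0, oi, oj) + (1, vi, vj)) k - hcpSite a h (qk, qi, qj) k =
      ![a * (((vi - oi : ℤ) : ℝ) + ((vj - oj : ℤ) : ℝ) / 2 - 1 / 2), a * √3 / 2 * (((vj - oj : ℤ) : ℝ) - 1 / 3), h] k := by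
  have hk1 : Even (qk + 1) := by rw [Int.even_add_one]; exact hk
  fin_cases k <;> simp [hcpSite_apply_zero, hcpSite_apply_one, hcpSite_apply_two, haggLabel_alternating, hk, hk1] <;> ring

/-- Coordinate differences `y_{q−o+v} − y_q`, odd layer, vertex one layer down. -/
theorem hcpSite_diff_odd10 (a h : ℝ) {qk : ℤ} (hk : ¬Even qk) (qi qj oi oj vi vj : ℤ) (k : Fin 3) :
    hcpSite a h ((qk, qi, qj) - (1, oi, oj) + (0, vi, vj)) k - hcpSite a h (qk, qi, qj) k =
      ![a * (((vi - oi : ℤ) : ℝ) + ((vj - oj : ℤ) : ℝ) / 2 - 1 / 2), a * √3 / 2 * (((vj - oj : ℤ) : ℝ) - 1 / 3), -h] k := by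
  have hk1 : Even (qk - 1) := by rw [Int.even_sub_one]; exact hk
  fin_cases k <;> simp [hcpSite_apply_zero, hcpSite_apply_one, hcpSite_apply_two, haggLabel_alternating, hk, hk1] <;> ring

/-- Even-layer case of `p1StarSum_cellsq`. -/
private theorem p1StarSum_cellsq_even (a h : ℝ) (qk qi qj : ℤ) (hk : Even qk) (k l : Fin 3) :
    (let F : ℤ × ℤ × ℤ → Fin 6 → ℝ := fun o π =>
        (∑ m' : Fin 4, (hcpSite a h (((qk, qi, qj) - o) + p1VertOff (p1Par ((qk, qi, qj) - o)) π m') k - hcpSite a h (qk, qi, qj) k)) *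
          (∑ m' : Fin 4, (hcpSite a h (((qk, qi, qj) - o) + p1VertOff (p1Par ((qk, qi, qj) - o)) π m') l - hcpSite a h (qk, qi, qj) l))
     (F (0, 0, 0) 0 + F (0, 0, 1) 0 + F (0, 0, 1) 2 + F (0, 0, 1) 3 + F (0, 0, 1) 4 + F (0, 0, 1) 5 + F (0, 1, 0) 0 + F (0, 1, 0) 2 + F (0, 1, 0) 3 + F (0, 1, 1) 1 + F (0, 1, 1) 2 + F (0, 1, 1) 5 + F (1, 0, 0) 0 + F (1, 0, 1) 0 + F (1, 0, 1) 2 + F (1, 0, 1) 3 + F (1, 0, 1) 4 + F (1, 0, 1) 5 + F (1, 1, 0) 0 + F (1, 1, 0) 2 + F (1, 1, 0) 3 + F (1, 1, 1) 1 + F (1, 1, 1) 2 + F (1, 1, 1) 5)) =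
      (!![60 * a ^ 2, -(20 / 3) * √3 * a ^ 2, 0; -(20 / 3) * √3 * a ^ 2, 140 / 3 * a ^ 2, 0; 0, 0, 80 * h ^ 2] : Matrix (Fin 3) (Fin 3) ℝ) k l := by
  have h3 : √3 * √3 = 3 := Real.mul_self_sqrt (by norm_num)
  have hbot : ∀ i j : ℤ, p1Par ((qk, qi, qj) - (0, i, j)) = decide (Even qk) := fun i j => by simp [p1Par]
  have htop : ∀ i j : ℤ, p1Par ((qk, qi, qj) - (1, i, j)) = !decide (Even qk) := fun i j => by
    by_cases hk' : Even qk
    · have hk1 : ¬Even (qk - 1) := by rw [Int.even_sub_one]; exact not_not.2 hk'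
      simp [p1Par, hk', hk1]
    · have hk1 : Even (qk - 1) := by rw [Int.even_sub_one]; exact hk'
      simp [p1Par, hk', hk1]
  simp only [hbot, htop, hk, decide_true, Bool.not_true, p1VertOff, Fin.sum_univ_four, hcpSite_diff00, hcpSite_diff11, hcpSite_diff_even01 a h hk, hcpSite_diff_even10 a h hk]
  simp only [sub_self, sub_zero, zero_sub, Int.cast_zero, Int.cast_one, Int.cast_neg, mul_zero, zero_div, add_zero, zero_add]
  fin_cases k <;> fin_cases l <;> simp only [Fin.zero_eta, Fin.mk_one, Fin.reduceFinMk, Fin.isValue, Matrix.of_apply, Matrix.cons_val_zero, Matrix.cons_val_one, Matrix.cons_val_two, Matrix.vecHead, Matrix.vecTail, Function.comp_apply, Fin.succ_zero_eq_one] <;>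
    first | ring1 | linear_combination (140 / 9 * a ^ 2) * h3

/-- Odd-layer case of `p1StarSum_cellsq`. -/
private theorem p1StarSum_cellsq_odd (a h : ℝ) (qk qi qj : ℤ) (hk : ¬Even qk) (k l : Fin 3) :
    (let F : ℤ × ℤ × ℤ → Fin 6 → ℝ := fun o π =>
        (∑ m' : Fin 4, (hcpSite a h (((qk, qi, qj) - o) + p1VertOff (p1Par ((qk, qi, qj) - o)) π m') k - hcpSite a h (qk, qi, qj) k)) *
          (∑ m' : Fin 4, (hcpSite a h (((qk, qi, qj) - o) + p1VertOff (p1Par ((qk, qi, qj) - o)) π m') l - hcpSite a h (qk, qi, qj) l))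
     (F (0, 0, 0) 0 + F (0, 0, 0) 3 + F (0, 0, 0) 4 + F (0, 0, 1) 1 + F (0, 0, 1) 4 + F (0, 0, 1) 5 + F (0, 1, 0) 1 + F (0, 1, 0) 2 + F (0, 1, 0) 3 + F (0, 1, 0) 4 + F (0, 1, 0) 5 + F (0, 1, 1) 1 + F (1, 0, 0) 0 + F (1, 0, 0) 3 + F (1, 0, 0) 4 + F (1, 0, 1) 1 + F (1, 0, 1) 4 + F (1, 0, 1) 5 + F (1, 1, 0) 1 + F (1, 1, 0) 2 + F (1, 1, 0) 3 + F (1, 1, 0) 4 + F (1, 1, 0) 5 + F (1, 1, 1) 1)) =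
      (!![60 * a ^ 2, -(20 / 3) * √3 * a ^ 2, 0; -(20 / 3) * √3 * a ^ 2, 140 / 3 * a ^ 2, 0; 0, 0, 80 * h ^ 2] : Matrix (Fin 3) (Fin 3) ℝ) k l := by
  have h3 : √3 * √3 = 3 := Real.mul_self_sqrt (by norm_num)
  have hbot : ∀ i j : ℤ, p1Par ((qk, qi, qj) - (0, i, j)) = decide (Even qk) := fun i j => by simp [p1Par]
  have htop : ∀ i j : ℤ, p1Par ((qk, qi, qj) - (1, i, j)) = !decide (Even qk) := fun i j => by
    by_cases hk' : Even qk
    · have hk1 : ¬Even (qk - 1) := by rw [Int.even_sub_one]; exact not_not.2 hk'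
      simp [p1Par, hk', hk1]
    · have hk1 : Even (qk - 1) := by rw [Int.even_sub_one]; exact hk'
      simp [p1Par, hk', hk1]
  simp only [hbot, htop, hk, decide_false, Bool.not_false, p1VertOff, Fin.sum_univ_four, hcpSite_diff00, hcpSite_diff11, hcpSite_diff_odd01 a h hk, hcpSite_diff_odd10 a h hk]
  simp only [sub_self, sub_zero, zero_sub, Int.cast_zero, Int.cast_one, Int.cast_neg, mul_zero, zero_div, add_zero, zero_add]
  fin_cases k <;> fin_cases l <;> simp only [Fin.zero_eta, Fin.mk_one, Fin.reduceFinMk, Fin.isValue, Matrix.of_apply, Matrix.cons_val_zero, Matrix.cons_val_one, Matrix.cons_val_two, Matrix.vecHead, Matrix.vecTail, Function.comp_apply, Fin.succ_zero_eq_one] <;>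
    first | ring1 | linear_combination (140 / 9 * a ^ 2) * h3

/-- The cell-sum part evaluated: `Σ_{cells} s_{T,k}s_{T,l}` with `s_T = Σ_{m'}(y_{(q−o)+v_{m'}} − y_q)`. -/
theorem p1StarSum_cellsq (a h : ℝ) (q : ℤ × ℤ × ℤ) (k l : Fin 3) :
    (let F : ℤ × ℤ × ℤ → Fin 6 → ℝ := fun o π =>
        (∑ m' : Fin 4, (hcpSite a h ((q - o) + p1VertOff (p1Par (q - o)) π m') k - hcpSite a h q k)) *
          (∑ m' : Fin 4, (hcpSite a h ((q - o) + p1VertOff (p1Par (q - o)) π m') l - hcpSite a h q l))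
     if Even q.1 then
        (F (0, 0, 0) 0 + F (0, 0, 1) 0 + F (0, 0, 1) 2 + F (0, 0, 1) 3 + F (0, 0, 1) 4 + F (0, 0, 1) 5 + F (0, 1, 0) 0 + F (0, 1, 0) 2 + F (0, 1, 0) 3 + F (0, 1, 1) 1 + F (0, 1, 1) 2 + F (0, 1, 1) 5 + F (1, 0, 0) 0 + F (1, 0, 1) 0 + F (1, 0, 1) 2 + F (1, 0, 1) 3 + F (1, 0, 1) 4 + F (1, 0, 1) 5 + F (1, 1, 0) 0 + F (1, 1, 0) 2 + F (1, 1, 0) 3 + F (1, 1, 1) 1 + F (1, 1, 1) 2 + F (1, 1, 1) 5)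
      else
        (F (0, 0, 0) 0 + F (0, 0, 0) 3 + F (0, 0, 0) 4 + F (0, 0, 1) 1 + F (0, 0, 1) 4 + F (0, 0, 1) 5 + F (0, 1, 0) 1 + F (0, 1, 0) 2 + F (0, 1, 0) 3 + F (0, 1, 0) 4 + F (0, 1, 0) 5 + F (0, 1, 1) 1 + F (1, 0, 0) 0 + F (1, 0, 0) 3 + F (1, 0, 0) 4 + F (1, 0, 1) 1 + F (1, 0, 1) 4 + F (1, 0, 1) 5 + F (1, 1, 0) 1 + F (1, 1, 0) 2 + F (1, 1, 0) 3 + F (1, 1, 0) 4 + F (1, 1, 0) 5 + F (1, 1, 1) 1)) =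
      (!![60 * a ^ 2, -(20 / 3) * √3 * a ^ 2, 0; -(20 / 3) * √3 * a ^ 2, 140 / 3 * a ^ 2, 0; 0, 0, 80 * h ^ 2] : Matrix (Fin 3) (Fin 3) ℝ) k l := by
  obtain ⟨qk, qi, qj⟩ := q
  rcases Int.even_or_odd qk with hk | hk
  · simp only [hk, if_true]
    exact p1StarSum_cellsq_even a h qk qi qj hk k l
  · have hk0 : ¬Even qk := Int.not_even_iff_odd.2 hk
    simp only [hk0, if_false]
    exact p1StarSum_cellsq_odd a h qk qi qj hk0 k l

/-- **THE EXACT HAT SECOND-MOMENT MATRIX (star form)**: for every site `q` and coordinates `k, l`,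
`Σ_{incidences (o,π,m) of the star of q} ∫_{cell (q−o,π)} λ_m(y)(y_k − (y_q)_k)(y_l − (y_q)_l) dy = (√3a²h/2)·Σ₂,kl`,
`Σ₂ = [[a²/8, −(√3/72)a², 0], [−(√3/72)a², 7a²/72, 0], [0, 0, h²/6]]` (both parities), i.e. `∫φ_q(y−y_q)(y−y_q)ᵀ = V_site·Σ₂`.
NOT a proof of H12⋆, NOT summit progress. -/
theorem p1Hat_secondMoment {a h : ℝ} (ha : 0 < a) (hh : 0 < h) (q : ℤ × ℤ × ℤ) (k l : Fin 3) :
    (∑ o ∈ p1Corners, ∑ π : Fin 6, ∑ m : Fin 4,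
        if p1VertOff (p1Par (q - o)) π m = o then
          ∫ y in p1RealCell a h (q - o, π), p1Lam a h (q - o, π) m y * ((y k - hcpSite a h q k) * (y l - hcpSite a h q l)) else 0) =
      √3 * a ^ 2 * h / 2 * (!![a ^ 2 / 8, -(√3 / 72) * a ^ 2, 0; -(√3 / 72) * a ^ 2, 7 * a ^ 2 / 72, 0; 0, 0, h ^ 2 / 6] : Matrix (Fin 3) (Fin 3) ℝ) k l := by
  -- each incidence: the cell lemma with vertex m at q
  have hinc : ∀ o π m, p1VertOff (p1Par (q - o)) π m = o →
      ∫ y in p1RealCell a h (q - o, π), p1Lam a h (q - o, π) m y * ((y k - hcpSite a h q k) * (y l - hcpSite a h q l)) =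
        √3 * a ^ 2 * h / 1440 *
          ((∑ m' : Fin 4, (hcpSite a h ((q - o) + p1VertOff (p1Par (q - o)) π m') k - hcpSite a h q k) *
              (hcpSite a h ((q - o) + p1VertOff (p1Par (q - o)) π m') l - hcpSite a h q l)) +
            (∑ m' : Fin 4, (hcpSite a h ((q - o) + p1VertOff (p1Par (q - o)) π m') k - hcpSite a h q k)) *
              (∑ m' : Fin 4, (hcpSite a h ((q - o) + p1VertOff (p1Par (q - o)) π m') l - hcpSite a h q l))) := by
    intro o π m ho
    have hq : (q - o) + p1VertOff (p1Par (q - o)) π m = q := by rw [ho]; abel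
    have := setIntegral_p1Lam_mul_coord_sub_mul ha hh (q - o, π) m k l
    simp only [hq] at this
    exact this
  have hG := p1Star_sum_offsets q (fun d => (hcpSite a h (q + d) k - hcpSite a h q k) * (hcpSite a h (q + d) l - hcpSite a h q l))
  have hF := p1Star_sum_cells q (fun o π =>
        (∑ m' : Fin 4, (hcpSite a h ((q - o) + p1VertOff (p1Par (q - o)) π m') k - hcpSite a h q k)) *
          (∑ m' : Fin 4, (hcpSite a h ((q - o) + p1VertOff (p1Par (q - o)) π m') l - hcpSite a h q l)))
  have hE := p1StarSum_edgeprod a h q k l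
  have hC := p1StarSum_cellsq a h q k l
  simp only [] at hE hC
  -- rewrite the incidence sum as (√3a²h/1440) * (edge part + cell part)
  have hsplit : (∑ o ∈ p1Corners, ∑ π : Fin 6, ∑ m : Fin 4,
        if p1VertOff (p1Par (q - o)) π m = o then
          ∫ y in p1RealCell a h (q - o, π), p1Lam a h (q - o, π) m y * ((y k - hcpSite a h q k) * (y l - hcpSite a h q l)) else 0) =
      √3 * a ^ 2 * h / 1440 *
        ((∑ o ∈ p1Corners, ∑ π : Fin 6, ∑ m : Fin 4,
            if p1VertOff (p1Par (q - o)) π m = o then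
              ∑ m' : Fin 4, (fun d => (hcpSite a h (q + d) k - hcpSite a h q k) * (hcpSite a h (q + d) l - hcpSite a h q l))
                (p1VertOff (p1Par (q - o)) π m' - o) else 0) +
          (∑ o ∈ p1Corners, ∑ π : Fin 6, ∑ m : Fin 4,
            if p1VertOff (p1Par (q - o)) π m = o then
              (∑ m' : Fin 4, (hcpSite a h ((q - o) + p1VertOff (p1Par (q - o)) π m') k - hcpSite a h q k)) *
                (∑ m' : Fin 4, (hcpSite a h ((q - o) + p1VertOff (p1Par (q - o)) π m') l - hcpSite a h q l)) else 0)) := by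
    rw [mul_add, Finset.mul_sum, Finset.mul_sum, ← Finset.sum_add_distrib]
    refine Finset.sum_congr rfl fun o _ => ?_
    rw [Finset.mul_sum, Finset.mul_sum, ← Finset.sum_add_distrib]
    refine Finset.sum_congr rfl fun π _ => ?_
    rw [Finset.mul_sum, Finset.mul_sum, ← Finset.sum_add_distrib]
    refine Finset.sum_congr rfl fun m _ => ?_
    split_ifs with ho
    · rw [hinc o π m ho, mul_add]
      congr 2
      refine Finset.sum_congr rfl fun m' _ => ?_
      simp only []
      rw [show q - o + p1VertOff (p1Par (q - o)) π m' = q + (p1VertOff (p1Par (q - o)) π m' - o) by abel]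
    · simp
  rw [hsplit, hG, hF, hE, hC]
  fin_cases k <;> fin_cases l <;> simp <;> ring

/-- **The exact trace of the hat second moment** (the Jensen bound `p1Hat_secondMoment_le` of part 25b is exactly twice this): for every site `q`,
`Σ_{incidences} ∫_T λ_q(y)|y − y_q|² dy = (√3a²h/2)·tr Σ₂ = (√3a²h/2)·((2/9)a² + h²/6)` (`= V_site·a²/3` at the ideal ratio `h² = (2/3)a²`).
NOT a proof of H12⋆, NOT summit progress. -/
theorem p1Hat_secondMoment_trace {a h : ℝ} (ha : 0 < a) (hh : 0 < h) (q : ℤ × ℤ × ℤ) :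
    (∑ o ∈ p1Corners, ∑ π : Fin 6, ∑ m : Fin 4,
        if p1VertOff (p1Par (q - o)) π m = o then
          ∫ y in p1RealCell a h (q - o, π), p1Lam a h (q - o, π) m y * ∑ k : Fin 3, (y k - hcpSite a h q k) ^ 2 else 0) =
      √3 * a ^ 2 * h / 2 * (2 / 9 * a ^ 2 + h ^ 2 / 6) := by
  -- split each cell integral into the three diagonal entries
  have hcell : ∀ (o : ℤ × ℤ × ℤ) (π : Fin 6) (m : Fin 4),
      (∫ y in p1RealCell a h (q - o, π), p1Lam a h (q - o, π) m y * ∑ k : Fin 3, (y k - hcpSite a h q k) ^ 2) =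
        ∑ k : Fin 3, ∫ y in p1RealCell a h (q - o, π),
          p1Lam a h (q - o, π) m y * ((y k - hcpSite a h q k) * (y k - hcpSite a h q k)) := by
    intro o π m
    have hK := isCompact_p1RealCell ha.ne' hh.ne' (q - o, π)
    have hcl := continuous_p1Lam a h (q - o, π) m
    have hint : ∀ k ∈ (Finset.univ : Finset (Fin 3)), IntegrableOn
        (fun y : Fin 3 → ℝ => p1Lam a h (q - o, π) m y * ((y k - hcpSite a h q k) * (y k - hcpSite a h q k)))
        (p1RealCell a h (q - o, π)) volume := by
      intro k _
      have hc : Continuous fun y : Fin 3 → ℝ => (y k - hcpSite a h q k) * (y k - hcpSite a h q k) := by fun_prop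
      exact (hcl.mul hc).continuousOn.integrableOn_compact hK
    rw [← integral_finsetSum Finset.univ hint]
    refine integral_congr_ae (Filter.Eventually.of_forall fun y => ?_)
    simp only [Finset.mul_sum]
    refine Finset.sum_congr rfl fun k _ => ?_
    ring
  have hite : ∀ (p : Prop) [Decidable p] (g : Fin 3 → ℝ), (if p then ∑ k : Fin 3, g k else 0) = ∑ k : Fin 3, (if p then g k else 0) := by
    intro p _ g
    split_ifs <;> simp
  have hswap : (∑ k : Fin 3, ∑ o ∈ p1Corners, ∑ π : Fin 6, ∑ m : Fin 4,
        if p1VertOff (p1Par (q - o)) π m = o then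
          ∫ y in p1RealCell a h (q - o, π), p1Lam a h (q - o, π) m y * ((y k - hcpSite a h q k) * (y k - hcpSite a h q k)) else 0) =
      ∑ o ∈ p1Corners, ∑ π : Fin 6, ∑ m : Fin 4, ∑ k : Fin 3,
        if p1VertOff (p1Par (q - o)) π m = o then
          ∫ y in p1RealCell a h (q - o, π), p1Lam a h (q - o, π) m y * ((y k - hcpSite a h q k) * (y k - hcpSite a h q k)) else 0 := by
    rw [Finset.sum_comm]
    refine Finset.sum_congr rfl fun o _ => ?_
    rw [Finset.sum_comm]
    refine Finset.sum_congr rfl fun π _ => ?_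
    rw [Finset.sum_comm]
  simp only [hcell, hite]
  rw [← hswap, Finset.sum_congr rfl fun k _ => p1Hat_secondMoment ha hh q k k]
  simp [Fin.sum_univ_three]
  ring


end Summit.AtomisticToContinuum.Crystallization.Theorems.StrictSplittingRuleBirth

end
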